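import Literature.NumberTheory.LFunctions.FourthMomentDirichletGeneralModulus
import HarnessLib

/-!
# The twisted and the mollified shifted fourth moment of Dirichlet `L`-functions to a GENERAL
# modulus (Gao–Wu–Zhao 2025, arXiv:2509.24690, Theorems 1.1 and 1.2) — CLAIMS of an unrefereed
# preprint

Topic `Literature/NumberTheory/LFunctions` (namespace `Literature.NumberTheory.LFunctions`,
sub-namespace `GWZ2025` for the paper's objects). STATEMENT LAYER (D-0012/D-0014: the source is an
unrefereed arXiv preprint, so every statement it proves is a named `Prop` tagged
`[claim: GaoWuZhao2025MollifiedFourthMoment, status: under-review]`; nothing deep is asserted).  Typed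
for the cell `landau-siegel` (LANDAU–SIEGEL PROGRAMME, rung F-S3, §C literature harvest, HARVEST
T-136 = r8-T30; allowed by the §C lead 2026-08-26T18:44:50Z because it completes the degree-4
length-record set quoted by the cell's price lines): the 2025 exchange rate for «four `L`-factors
`+ |A|²` at ONE general modulus» — an asymptotic with main terms while the mollifier length `y`
stays below `q^{1/22}` (`gwz_length_exponent`), versus the upper bound to `q^{1/4}` of
`bhkm2020_theorem4` and the untwisted `wu2023_theorem11/12` (sister files).  It re-uses the carriers
`zetaQ` (`ζ_q`), `zQ` (`Z_q`), `xFactor` (`X_α`), `ShiftsOffPoles`, `shiftedMoment`, `cfkrsMainTerm`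
of `FourthMomentDirichletGeneralModulus.lean` and `primitiveCount` (`φ*(q)`) of
`FourthMomentDirichletPrimeModulus.lean`.  None of this is a statement about arXiv:2211.02515 or
about Siegel zeros.

## What the source prints (P. Gao, X. Wu, L. Zhao, *The mollified fourth moment of Dirichlet
## `L`-functions*, arXiv:2509.24690v2 (29 Oct 2025); held text `paper:arxiv-2509.24690` p0004 and
## the e-print TeX `mollifiermoment1027.tex` l.272–372 read 2026-08-26; numbering
## `\numberwithin{theorem}{section}` (TeX l.167): §1.1 «Main results» = Theorem 1.1, Theorem 1.2)

* §1 (l.272–298): the mollified moment has "`A(1/2,χ) = Σ_{h ≤ y} α_h χ(h)/√h` with the coefficients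
  satisfying `α_h ≪ h^ε`"; "we consider only the case of even characters … we define
  `M_{h,k}(α,β,γ,δ) := (2/φ*(q)) Σ⁺_{χ (mod q)} L(1/2+α,χ)L(1/2+β,χ)L(1/2+γ,χ̄)L(1/2+δ,χ̄) χ(h k̄)`,
  `M(α,β,γ,δ) := (2/φ*(q)) Σ⁺_{χ (mod q)} L(1/2+α,χ)L(1/2+β,χ)L(1/2+γ,χ̄)L(1/2+δ,χ̄) |A(1/2,χ)|²`, where
  `k̄` denotes the inverse of `k` modulo `q`, the symbol `Σ⁺` henceforth indicates that the summation
  is over all primitive even characters".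
* Notation (l.301–324): `X_{α,γ} = X_αX_γ`, `X_{α,β,γ,δ} = X_αX_βX_γX_δ`,
  `X_α = (q/π)^{−α}Γ((1/2−α)/2)/Γ((1/2+α)/2)`; "`Z_{h,k,q}(α,β,γ,δ) = Y_h(α,β,γ,δ)Y_k(γ,δ,α,β)Z_q(α,β,γ,δ)`
  where `Z_q(α,β,γ,δ) = ζ_q(1+α+γ)ζ_q(1+α+δ)ζ_q(1+β+γ)ζ_q(1+β+δ)/ζ_q(2+α+β+γ+δ)` with `ζ_q(s)` the
  Euler product of `ζ(s)` with the primes dividing `q` removed and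
  `Y_a(α,β,γ,δ) = a^{−γ} Σ_{d|a} d^{γ−δ} ∏_{p|d} (1 − p^{−1−α−γ})(1 − p^{−1−β−γ})(1 − p^{−2−α−β−γ−δ})^{−1}`."
* **Theorem 1.1** (l.328–341; p0004:L40–55): "let `h,k` be integers satisfying `(h,k) = (hk,q) = 1`.
  Then there exists `η > 0` such that for `α,β,γ,δ ∈ {z ∈ ℂ : Re(z) < η/log q}`, we have
  `M_{h,k}(α,β,γ,δ) = (hk)^{−1/2}𝔐_{h,k}(α,β,γ,δ) + O(q^{−1/20+ε}(|h|+|k|)^{3/10}Δ^{O(1)})`, where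
  `Δ = (1+|α|)(1+|β|)(1+|γ|)(1+|δ|)` and `𝔐_{h,k}(α,β,γ,δ) = Z_{h,k,q}(α,β,γ,δ) + X_{α,β,γ,δ}Z_{h,k,q}(−γ,−δ,−α,−β)
  + X_{α,γ}Z_{h,k,q}(β,−γ,δ,−α) + X_{β,γ}Z_{h,k,q}(α,−γ,δ,−β) + X_{α,δ}Z_{h,k,q}(β,−δ,γ,−α)
  + X_{β,δ}Z_{h,k,q}(α,−δ,γ,−β)`."
* **Theorem 1.2** (l.344–349; p0004:L59–66): "there exists `η > 0` such that for
  `α,β,γ,δ ∈ {z ∈ ℂ : Re(z) < η/log q}`, we have `M(α,β,γ,δ) = Σ_{ah,ak ≤ y; (ahk,q)=1; (h,k)=1}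
  (α_{ah} \overline{α_{ak}}/(ahk)) 𝔐_{h,k}(α,β,γ,δ) + O(q^{−1/20+ε} y^{11/10} Δ^{O(1)})`."
  Remark (l.358): "valid (the main term dominates the `O`-term) if the length of the mollifier does not
  exceed `q^{1/22−ε}`"; (l.355) with `h = k = 1` and zero shifts Theorem 1.1 recovers the fourth
  moment of X. Wu 2023 with error `q^{−1/20+ε}`.

## Lean rendering / design choices (weaker than print where it says so)

* Carriers from the sister files, not re-declared: `φ*(q)`, `L(s,χ)` (Mathlib), `χ̄ = χ⁻¹`, `ζ_q`,
  `Z_q`, `X_α` (`xFactor q 0`), the off-pole guard `ShiftsOffPoles`.  New here: `Y_a` (`yFactor`),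
  `Z_{h,k,q}` (`zHKQ`), `𝔐_{h,k}` (`frakM`, a FUNCTION — the six-term conjectural shape is never declared
  as a statement), `M_{h,k}` (`twistedShiftedMoment`, twist `χ(h k̄) = χ(h·k⁻¹)` in `ZMod q`), `A(1/2,χ)`
  (`dirichletPolyA`, length `⌊y⌋`), `M` (`mollifiedShiftedMoment`, `|A|²` inserted as a real
  scalar), `Δ` (`shiftSize`), and the main term of Theorem 1.2 (`mollifiedMainTerm`, a finite sum over
  `(a,h,k) ∈ [1,⌊y⌋]³`).
* `≪`/`O(·)` and `Δ^{O(1)}`: "there exists `η > 0`" absolute; the `O(1)` exponent is an absolute `B`;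
  for every `ε > 0` a constant `C(ε)`; a threshold `q ≥ q₀` is included (an `O`-statement in `q`;
  harmless) and `q ≢ 2 (mod 4)` (else `φ*(q) = 0` and `M` is not defined in print either).
* Shifts: the printed region is the half-plane `Re z < η/log q`; we type the STRIP `|Re z| < η/log q`
  (the regime the proof treats; a subset, hence weaker than print) with ARBITRARY imaginary parts,
  polynomial losses carried by `Δ^B` as printed, and — as for `wu2023_theorem12` — pointwise off the
  removable polar set of the individual `ζ_q(1+·)` factors (`ShiftsOffPoles`).
* Coefficients: the printed class "`α_h ≪ h^ε`" is rendered by the sub-class `|α_h| ≤ 1` for all `h`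
  (bounded coefficients, e.g. Möbius-type mollifiers), for which the printed implied constants are
  uniform; `TODO(general form): α_h ≪ h^ε` (every `ε' > 0` with its own constant).  Weaker than print.
* `h, k ≥ 1` natural numbers (`|h|+|k| = h+k`), `(h,k) = 1`, `(hk,q) = 1` verbatim; `y ≥ 1` real.
* NOT typed (index only): Theorems 1.3–1.4 (`thKls`, `thKls1`: new bounds for sums of Kloosterman
  sums, §1.2) and everything from §2 on; the Remark's comparison sentences are docstring-only.

PROVED here (bookkeeping only): `yFactor_one` (`Y_1 = 1`), `zHKQ_one_one` (`Z_{1,1,q} = Z_q`),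
`frakM_one_one` (`𝔐_{1,1} =` the CFKRS six-term main term `cfkrsMainTerm` of the sister file),
`twistedShiftedMoment_one_one` (`M_{1,1} = M` of X. Wu), `gwz_length_exponent`
(`−1/20 + (11/10)θ < 0 ↔ θ < 1/22`: the printed validity range `y < q^{1/22}`), `shiftSize_pos`.
Nothing else is claimed.  Harvest tag: E*-len (degree 4 `+ |A|²` at ONE general modulus; asymptotic
length record `1/22`); what it would need to bite: `θ* = 1` is `22×` farther, and the saving `1/20` is
a Cauchy–Schwarz-diagonal artefact common to the prime and general methods (source Remark, l.356).

## References

* [GaoWuZhao2025MollifiedFourthMoment] §1, Theorems 1.1–1.2, Remark — arXiv:2509.24690v2 TeX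
  l.272–372 (held text p0004).
* Sister files: `FourthMomentDirichletGeneralModulus.lean` ([WuXiaosheng2023FourthMoment]),
  `FourthMomentDirichletPrimeModulus.lean` ([Young2011], [BlomerHumphriesKhanMilinovich2020], …).
-/

noncomputable section

open Finset Complex

namespace Literature.NumberTheory.LFunctions

namespace GWZ2025

open FourthMomentPrimeModulus FourthMomentGeneralModulus

/-! ### The objects of §1 -/

/-- `Y_a(α,β,γ,δ) = a^{−γ} Σ_{d ∣ a} d^{γ−δ} ∏_{p ∣ d} (1 − p^{−1−α−γ})(1 − p^{−1−β−γ})(1 − p^{−2−α−β−γ−δ})^{−1}`.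
[cite: GaoWuZhao2025MollifiedFourthMoment, §1 (definition of Y_a)] -/
def yFactor (a : ℕ) (α β γ δ : ℂ) : ℂ :=
  (a : ℂ) ^ (-γ) * ∑ d ∈ a.divisors, (d : ℂ) ^ (γ - δ) *
    ∏ p ∈ d.primeFactors, (1 - (p : ℂ) ^ (-(1 + α + γ))) * (1 - (p : ℂ) ^ (-(1 + β + γ))) *
      (1 - (p : ℂ) ^ (-(2 + α + β + γ + δ)))⁻¹

/-- `Z_{h,k,q}(α,β,γ,δ) = Y_h(α,β,γ,δ) Y_k(γ,δ,α,β) Z_q(α,β,γ,δ)` (`Z_q` = the sister file's `zQ`).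
[cite: GaoWuZhao2025MollifiedFourthMoment, §1 (definition of Z_{h,k,q})] -/
def zHKQ (q h k : ℕ) (α β γ δ : ℂ) : ℂ :=
  yFactor h α β γ δ * yFactor k γ δ α β * zQ q α β γ δ

/-- The six-term main term `𝔐_{h,k}(α,β,γ,δ)` of Theorem 1.1 (even characters, `X_α` at `𝔞 = 0`):
`Z_{h,k,q}(α,β,γ,δ) + X_{α,β,γ,δ}Z_{h,k,q}(−γ,−δ,−α,−β) + X_{α,γ}Z_{h,k,q}(β,−γ,δ,−α)
+ X_{β,γ}Z_{h,k,q}(α,−γ,δ,−β) + X_{α,δ}Z_{h,k,q}(β,−δ,γ,−α) + X_{β,δ}Z_{h,k,q}(α,−δ,γ,−β)`.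
A FUNCTION of the data; no asymptotic is asserted by this definition.
[cite: GaoWuZhao2025MollifiedFourthMoment, Theorem 1.1 (definition of 𝔐_{h,k})] -/
def frakM (q h k : ℕ) (α β γ δ : ℂ) : ℂ :=
  zHKQ q h k α β γ δ +
    xFactor q 0 α * xFactor q 0 β * xFactor q 0 γ * xFactor q 0 δ * zHKQ q h k (-γ) (-δ) (-α) (-β) +
    xFactor q 0 α * xFactor q 0 γ * zHKQ q h k β (-γ) δ (-α) +
    xFactor q 0 β * xFactor q 0 γ * zHKQ q h k α (-γ) δ (-β) +
    xFactor q 0 α * xFactor q 0 δ * zHKQ q h k β (-δ) γ (-α) +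
    xFactor q 0 β * xFactor q 0 δ * zHKQ q h k α (-δ) γ (-β)

open scoped Classical in
/-- The twisted shifted fourth moment over primitive EVEN characters,
`M_{h,k}(α,β,γ,δ) = (2/φ*(q)) Σ⁺_{χ (mod q)} L(1/2+α,χ)L(1/2+β,χ)L(1/2+γ,χ̄)L(1/2+δ,χ̄) χ(h k̄)`
(`χ̄ = χ⁻¹`; `χ(h k̄) = χ(h·k⁻¹)` in `ℤ/qℤ`, `k` a unit since `(k,q) = 1` in the theorems).
[cite: GaoWuZhao2025MollifiedFourthMoment, §1 (definition of M_{h,k}(α,β,γ,δ))] -/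
def twistedShiftedMoment (q : ℕ) [NeZero q] (h k : ℕ) (α β γ δ : ℂ) : ℂ :=
  2 / (primitiveCount q : ℂ) *
    ∑ χ : DirichletCharacter ℂ q with (χ.IsPrimitive ∧ χ.Even),
      χ.LFunction (1 / 2 + α) * χ.LFunction (1 / 2 + β) *
        χ⁻¹.LFunction (1 / 2 + γ) * χ⁻¹.LFunction (1 / 2 + δ) *
        χ ((h : ZMod q) * (k : ZMod q)⁻¹)

/-- The Dirichlet polynomial `A(1/2,χ) = Σ_{h ≤ y} α_h χ(h)/√h` (length `y ≥ 1`, sum over `1 ≤ h ≤ ⌊y⌋`).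
[cite: GaoWuZhao2025MollifiedFourthMoment, §1 (definition of A(1/2,χ))] -/
def dirichletPolyA (q : ℕ) (y : ℝ) (a : ℕ → ℂ) (χ : DirichletCharacter ℂ q) : ℂ :=
  ∑ h ∈ Icc 1 ⌊y⌋₊, a h * χ (h : ZMod q) / ((Real.sqrt h : ℝ) : ℂ)

open scoped Classical in
/-- The mollified shifted fourth moment over primitive EVEN characters,
`M(α,β,γ,δ) = (2/φ*(q)) Σ⁺_{χ (mod q)} L(1/2+α,χ)L(1/2+β,χ)L(1/2+γ,χ̄)L(1/2+δ,χ̄) |A(1/2,χ)|²`.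
[cite: GaoWuZhao2025MollifiedFourthMoment, §1 (definition of M(α,β,γ,δ))] -/
def mollifiedShiftedMoment (q : ℕ) [NeZero q] (y : ℝ) (a : ℕ → ℂ) (α β γ δ : ℂ) : ℂ :=
  2 / (primitiveCount q : ℂ) *
    ∑ χ : DirichletCharacter ℂ q with (χ.IsPrimitive ∧ χ.Even),
      χ.LFunction (1 / 2 + α) * χ.LFunction (1 / 2 + β) *
        χ⁻¹.LFunction (1 / 2 + γ) * χ⁻¹.LFunction (1 / 2 + δ) *
        ((‖dirichletPolyA q y a χ‖ ^ 2 : ℝ) : ℂ)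

/-- `Δ = (1+|α|)(1+|β|)(1+|γ|)(1+|δ|)`. [cite: GaoWuZhao2025MollifiedFourthMoment, Theorem 1.1 (definition of Δ)] -/
def shiftSize (α β γ δ : ℂ) : ℝ := (1 + ‖α‖) * (1 + ‖β‖) * (1 + ‖γ‖) * (1 + ‖δ‖)

/-- The main term of Theorem 1.2:
`Σ_{ah ≤ y, ak ≤ y, (ahk,q)=1, (h,k)=1} (α_{ah} \overline{α_{ak}} / (ahk)) 𝔐_{h,k}(α,β,γ,δ)`, as a finite sum
over `(a,h,k) ∈ [1,⌊y⌋]³` with the printed side conditions.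
[cite: GaoWuZhao2025MollifiedFourthMoment, Theorem 1.2 (the main term)] -/
def mollifiedMainTerm (q : ℕ) (y : ℝ) (c : ℕ → ℂ) (α β γ δ : ℂ) : ℂ :=
  ∑ a ∈ Icc 1 ⌊y⌋₊, ∑ h ∈ Icc 1 ⌊y⌋₊, ∑ k ∈ Icc 1 ⌊y⌋₊,
    if a * h ≤ ⌊y⌋₊ ∧ a * k ≤ ⌊y⌋₊ ∧ Nat.Coprime (a * h * k) q ∧ Nat.Coprime h k then
      c (a * h) * (starRingEnd ℂ) (c (a * k)) / ((a : ℂ) * h * k) * frakM q h k α β γ δ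
    else 0

/-- The shift region as typed: the strip `|Re z| < η/log q` for each of `α,β,γ,δ` (the printed region
is the half-plane `Re z < η/log q`; we restrict to the strip — weaker).
[cite: GaoWuZhao2025MollifiedFourthMoment, Theorems 1.1–1.2 (the shift region)] -/
def ShiftsInStrip (η : ℝ) (q : ℕ) (α β γ δ : ℂ) : Prop :=
  |α.re| < η / Real.log q ∧ |β.re| < η / Real.log q ∧ |γ.re| < η / Real.log q ∧
    |δ.re| < η / Real.log q

end GWZ2025

open FourthMomentPrimeModulus FourthMomentGeneralModulus GWZ2025

/-! ### The named claims (statement layer; NOT proved here; source unrefereed) -/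

/-- **Gao–Wu–Zhao 2025, Theorem 1.1** (twisted shifted fourth moment, general modulus), as printed:
"let `h,k` be integers satisfying `(h,k) = (hk,q) = 1`. Then there exists `η > 0` such that for
`α,β,γ,δ ∈ {z : Re(z) < η/log q}`, `M_{h,k}(α,β,γ,δ) = (hk)^{−1/2}𝔐_{h,k}(α,β,γ,δ)
+ O(q^{−1/20+ε}(|h|+|k|)^{3/10}Δ^{O(1)})`."  Rendered (see the module docstring for each weakening):
there are absolute `η > 0` and `B` such that for every `ε > 0` there are `q₀`, `C` with
`|M_{h,k} − (hk)^{−1/2}𝔐_{h,k}| ≤ C q^{−1/20+ε}(h+k)^{3/10}Δ^B` for all `q ≥ q₀`, `q ≢ 2 (mod 4)`,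
`h,k ≥ 1`, `(h,k) = 1`, `(hk,q) = 1`, and all shifts in the strip `|Re| < η/log q` off the removable
polar set.  An unrefereed preprint: [claim: GaoWuZhao2025MollifiedFourthMoment, status: under-review]
(named fact, not proved here). [cite: GaoWuZhao2025MollifiedFourthMoment, Theorem 1.1] -/
def gaoWuZhao2025_theorem11 : Prop :=
  ∃ η : ℝ, 0 < η ∧ ∃ B : ℝ, ∀ ε : ℝ, 0 < ε → ∃ q₀ : ℕ, ∃ C : ℝ, ∀ (q : ℕ) [NeZero q],
    q₀ ≤ q → q % 4 ≠ 2 → ∀ h k : ℕ, 1 ≤ h → 1 ≤ k → Nat.Coprime h k → Nat.Coprime (h * k) q →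
      ∀ α β γ δ : ℂ, ShiftsInStrip η q α β γ δ → ShiftsOffPoles α β γ δ →
        ‖twistedShiftedMoment q h k α β γ δ -
            ((((h : ℝ) * k) ^ (-(1 / 2 : ℝ)) : ℝ) : ℂ) * frakM q h k α β γ δ‖ ≤
          C * (q : ℝ) ^ (-(1 : ℝ) / 20 + ε) * ((h : ℝ) + k) ^ (3 / 10 : ℝ) *
            shiftSize α β γ δ ^ B

/-- **Gao–Wu–Zhao 2025, Theorem 1.2** (the mollified shifted fourth moment, general modulus), as
printed: "there exists `η > 0` such that for `α,β,γ,δ ∈ {z : Re(z) < η/log q}`, we have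
`M(α,β,γ,δ) = Σ_{ah,ak ≤ y; (ahk,q)=1; (h,k)=1} (α_{ah}\overline{α_{ak}}/(ahk)) 𝔐_{h,k}(α,β,γ,δ)
+ O(q^{−1/20+ε} y^{11/10} Δ^{O(1)})`" (coefficients `α_h ≪ h^ε`).  Rendered for BOUNDED coefficients
`|α_h| ≤ 1` (documented sub-class), shifts in the strip off the polar set, with absolute `η, B`, and
`q₀, C` depending on `ε`:
`|M − mollifiedMainTerm| ≤ C q^{−1/20+ε} y^{11/10} Δ^B` for `q ≥ q₀`, `q ≢ 2 (mod 4)`, `y ≥ 1`.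
Valid as an asymptotic while `y < q^{1/22−ε}` (Remark; `gwz_length_exponent`).  An unrefereed preprint:
[claim: GaoWuZhao2025MollifiedFourthMoment, status: under-review] (named fact, not proved here).
[cite: GaoWuZhao2025MollifiedFourthMoment, Theorem 1.2 and Remark] -/
def gaoWuZhao2025_theorem12 : Prop :=
  ∃ η : ℝ, 0 < η ∧ ∃ B : ℝ, ∀ ε : ℝ, 0 < ε → ∃ q₀ : ℕ, ∃ C : ℝ, ∀ (q : ℕ) [NeZero q],
    q₀ ≤ q → q % 4 ≠ 2 → ∀ y : ℝ, 1 ≤ y → ∀ c : ℕ → ℂ, (∀ h, ‖c h‖ ≤ 1) →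
      ∀ α β γ δ : ℂ, ShiftsInStrip η q α β γ δ → ShiftsOffPoles α β γ δ →
        ‖mollifiedShiftedMoment q y c α β γ δ - mollifiedMainTerm q y c α β γ δ‖ ≤
          C * (q : ℝ) ^ (-(1 : ℝ) / 20 + ε) * y ^ (11 / 10 : ℝ) * shiftSize α β γ δ ^ B

/-! ### Bookkeeping (proved) -/

/-- The Remark's validity range: with `y = q^θ` the error `q^{−1/20} y^{11/10}` beats the main term's
order `q^0` iff `θ < 1/22`. [cite: GaoWuZhao2025MollifiedFourthMoment, Remark after Theorem 1.2] -/
theorem gwz_length_exponent (θ : ℝ) : -(1 : ℝ) / 20 + 11 / 10 * θ < 0 ↔ θ < 1 / 22 := by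
  constructor <;> intro h <;> linarith

namespace GWZ2025

/-- `Δ ≥ 1 > 0`. [cite: GaoWuZhao2025MollifiedFourthMoment, Theorem 1.1 (definition of Δ)] -/
theorem shiftSize_pos (α β γ δ : ℂ) : 0 < shiftSize α β γ δ := by
  unfold shiftSize; positivity

/-- `Y_1(α,β,γ,δ) = 1` (the only divisor of `1` is `1`, with no prime factors).
[cite: GaoWuZhao2025MollifiedFourthMoment, §1 (definition of Y_a)] -/
theorem yFactor_one (α β γ δ : ℂ) : yFactor 1 α β γ δ = 1 := by
  simp [yFactor]

/-- `Z_{1,1,q} = Z_q`. [cite: GaoWuZhao2025MollifiedFourthMoment, §1 (definition of Z_{h,k,q})] -/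
theorem zHKQ_one_one (q : ℕ) (α β γ δ : ℂ) : zHKQ q 1 1 α β γ δ = zQ q α β γ δ := by
  simp [zHKQ, yFactor_one]

/-- With `h = k = 1` the main term `𝔐_{1,1}` IS the Conrey–Farmer–Keating–Rubinstein–Snaith six-term
main term `cfkrsMainTerm` of X. Wu's Theorem 1.2 (sister file) — the Remark's "if one sets `h = k = 1`
… Theorem 1.1 establishes an asymptotic formula for the fourth moment … as in [Wu23]".
[cite: GaoWuZhao2025MollifiedFourthMoment, Remark after Theorem 1.2 (first item)] -/
theorem frakM_one_one (q : ℕ) (α β γ δ : ℂ) : frakM q 1 1 α β γ δ = cfkrsMainTerm q α β γ δ := by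
  simp only [frakM, zHKQ_one_one, cfkrsMainTerm]

/-- With `h = k = 1` the twisted moment `M_{1,1}` is X. Wu's shifted moment `M` (the twist `χ(1·1̄) = 1`).
[cite: GaoWuZhao2025MollifiedFourthMoment, §1 (definitions of M_{h,k} and M)] -/
theorem twistedShiftedMoment_one_one (q : ℕ) [NeZero q] (α β γ δ : ℂ) :
    twistedShiftedMoment q 1 1 α β γ δ = shiftedMoment q α β γ δ := by
  classical
  unfold twistedShiftedMoment shiftedMoment
  congr 1
  refine sum_congr rfl fun χ _ => ?_
  simp

end GWZ2025

end Literature.NumberTheory.LFunctions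

end
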